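import Summits.Ventures.PercRepro.ClassPositive

/-!
# PercRepro — repeated marks: the C-011 class sum vanishes, the C-017 class sum stays nonnegative (typer-2, gen 4)

The censuses (p1, mine-3) enumerate INJECTIVE markings (4-subsets, 3-subsets), while
`LemmaBPlusSimpleUpTo` / `ClassPositiveSimpleUpTo` quantify over all marking maps (lead
07:22:00Z). The gap is closed here:

* **`phiPlusKernel_eq_zero_of_joined`** — the C-011 kernel vanishes on any pair of rows that both
  join the same two marks (by `decide` over the 15 × 15 rows), hence
  **`cubeSumC011_eq_zero_of_not_injective`**; **`LemmaBPlusSimpleInjUpTo N`** (the census over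
  4-subsets) and **`LemmaBPlusSimpleUpTo_of_inj`**, **`C011UpTo_of_simpleInj`**,
  **`C005UpTo_of_simpleInj`**;
* C-017: with `a = b` the kernel is pointwise nonnegative; with `a = c` (or `b = c`) the class
  sum is `#{ρ : row 2} − #{ρ : row 0 ∧ ρᶜ in row 2} ≥ 0` by the injection `ρ ↦ ρᶜ` (mine-3
  07:30:06Z) — **`cubeSumQuad_kernel17_nonneg_of_not_injective`**, `ClassPositiveSimpleInjUpTo`,
  **`ClassPositiveSimpleUpTo_kernel17_of_inj`**, **`C017UpTo_of_simpleInj`**.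
-/

namespace PercRepro

open Finset

/-! ### C-011: the kernel vanishes on rows joining a common pair -/

set_option maxRecDepth 20000 in
/-- The C-011 kernel vanishes on any two rows that both join the marks `i ≠ j`. -/
theorem phiPlusKernel_eq_zero_of_joined {s t : Fin 15} {i j : Fin 4} (hij : i ≠ j)
    (hs : rgs4 s i = rgs4 s j) (ht : rgs4 t i = rgs4 t j) : phiPlusKernel s t = 0 := by
  have key : ∀ s t : Fin 15, ∀ i j : Fin 4, i ≠ j → rgs4 s i = rgs4 s j → rgs4 t i = rgs4 t j →
      ¬ (s = 0 ∧ t = 14) ∧ (∀ q ∈ crossPairs4, ¬ (s = q.1 ∧ t = q.2)) ∧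
        ∀ q ∈ liabPairs4, ¬ (s = q.1 ∧ t = q.2) := by
    decide +kernel
  obtain ⟨h1, h2, h3⟩ := key s t i j hij hs ht
  unfold phiPlusKernel
  rw [if_neg h1, Finset.sum_eq_zero fun q hq => if_neg (h2 q hq),
    Finset.sum_eq_zero fun q hq => if_neg (h3 q hq)]
  ring

namespace MultiGraph

variable {V E : Type*} (G : MultiGraph V E) [Fintype E] [DecidableEq E]

omit [Fintype E] [DecidableEq E] in
/-- Two coinciding marks are joined in the row of every configuration. -/
theorem rgs4_row4_eq_of_eq (ω : Config E) (m : Fin 4 → V) {i j : Fin 4} (h : m i = m j) :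
    rgs4 (row4 (G.markedPartition ω m)) i = rgs4 (row4 (G.markedPartition ω m)) j := by
  have hmem := (G.row4_markedPartition_eq_iff m (row4 (G.markedPartition ω m))).mp rfl
  refine (hmem i j).mp ?_
  rw [h]
  exact Conn.refl _ _ _

/-- **The C-011 class sum vanishes for a non-injective marking.** -/
theorem cubeSumC011_eq_zero_of_not_injective (m : Fin 4 → V) (h : ¬ Function.Injective m) :
    G.cubeSumC011 m = 0 := by
  obtain ⟨i, j, hij, hne⟩ : ∃ i j, m i = m j ∧ i ≠ j := by
    unfold Function.Injective at h
    push Not at h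
    obtain ⟨i, j, h1, h2⟩ := h
    exact ⟨i, j, h1, h2⟩
  unfold cubeSumC011 cubeSum
  refine Finset.sum_eq_zero fun ρ _ => ?_
  exact phiPlusKernel_eq_zero_of_joined hne (G.rgs4_row4_eq_of_eq ρ m hij)
    (G.rgs4_row4_eq_of_eq ρᶜ m hij)

end MultiGraph

/-- **Lemma B⁺ on the full cube of every SIMPLE marked graph with at most `N` vertices and INJECTIVE
marks** — the census over 4-subsets, exactly as p1 / mine-3 enumerate it. -/
def LemmaBPlusSimpleInjUpTo (N : ℕ) : Prop :=
  ∀ {V E : Type} [Fintype V] [Fintype E] [DecidableEq E], Fintype.card V ≤ N →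
    ∀ (G : MultiGraph V E), G.IsSimple → ∀ m : Fin 4 → V, Function.Injective m →
      0 ≤ G.cubeSumC011 m

/-- The injective census gives the full hypothesis (repeated marks have class sum `0`). -/
theorem LemmaBPlusSimpleUpTo_of_inj {N : ℕ} (h : LemmaBPlusSimpleInjUpTo N) :
    LemmaBPlusSimpleUpTo N := by
  intro V E _ _ _ hV G hs m
  by_cases hm : Function.Injective m
  · exact h hV G hs m hm
  · rw [G.cubeSumC011_eq_zero_of_not_injective m hm]

/-- **C-011 on ≤ N vertices from the injective simple-graph census.** -/
theorem C011UpTo_of_simpleInj {N : ℕ} (h : LemmaBPlusSimpleInjUpTo N) : C011UpTo N :=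
  C011UpTo_of_simple (LemmaBPlusSimpleUpTo_of_inj h)

/-- **C-005 on ≤ N vertices from the injective simple-graph census.** -/
theorem C005UpTo_of_simpleInj {N : ℕ} (h : LemmaBPlusSimpleInjUpTo N) : C005UpTo N :=
  C005UpTo_of_simple (LemmaBPlusSimpleUpTo_of_inj h)

/-! ### C-017: repeated marks keep the class sum nonnegative -/

/-- `rowInd3` is nonnegative. -/
theorem rowInd3_nonneg (s : Fin 5) (σ : Setoid (Fin 3)) : 0 ≤ rowInd3 s σ := by
  unfold rowInd3
  split_ifs <;> norm_num

/-- A row indicator vanishes on a partition joining a pair that the row separates. -/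
theorem rowInd3_eq_zero_of_joined {s : Fin 5} {i j : Fin 3} (hs : rgs3 s i ≠ rgs3 s j)
    {σ : Setoid (Fin 3)} (hσ : σ i j) : rowInd3 s σ = 0 := by
  unfold rowInd3
  rw [if_neg]
  rintro rfl
  exact hs ((Setoid.ker_def).mp hσ)

namespace MultiGraph

variable {V E : Type*} (G : MultiGraph V E) [Fintype E] [DecidableEq E]

omit [Fintype E] [DecidableEq E] in
/-- Coinciding marks are joined by the marked partition of every configuration. -/
theorem markedPartition_rel_of_eq (ω : Config E) {k : ℕ} (m : Fin k → V) {i j : Fin k}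
    (h : m i = m j) : G.markedPartition ω m i j := by
  rw [G.markedPartition_rel, h]
  exact Conn.refl _ _ _

omit [Fintype E] [DecidableEq E] in
/-- `a = b`: the C-017 kernel is pointwise nonnegative. -/
theorem kernel17_nonneg_of_eq01 (ω ω' : Config E) (m : Fin 3 → V) (h : m 0 = m 1) :
    0 ≤ kernel17 (G.markedPartition ω m) (G.markedPartition ω' m) := by
  unfold kernel17
  have h2 := rowInd3_eq_zero_of_joined (s := 2) (by decide) (G.markedPartition_rel_of_eq ω' m h)
  have h3 := rowInd3_eq_zero_of_joined (s := 3) (by decide) (G.markedPartition_rel_of_eq ω' m h)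
  have h4 := rowInd3_eq_zero_of_joined (s := 4) (by decide) (G.markedPartition_rel_of_eq ω' m h)
  rw [h2, h3, h4]
  have := rowInd3_nonneg 1 (G.markedPartition ω m)
  have := rowInd3_nonneg 2 (G.markedPartition ω m)
  have := rowInd3_nonneg 3 (G.markedPartition ω m)
  linarith

/-- The class sum of `kernel17` when marks `i₀` and `j₀` coincide (`{i₀, j₀} = {0, 2}` or
`{1, 2}`): only the rows `0` and `s₀` (`2` resp. `3`) occur, and the negative pairs
`(row 0, row s₀)` inject into the positive configurations of row `s₀` by `ρ ↦ ρᶜ`. -/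
theorem cubeSumQuad_kernel17_nonneg_of_pair (m : Fin 3 → V) (s₀ : Fin 5) (i₀ j₀ : Fin 3)
    (h : m i₀ = m j₀) (hrows : ∀ s : Fin 5, rgs3 s i₀ = rgs3 s j₀ → s = 0 ∨ s = s₀)
    (hs₀ : s₀ = 2 ∨ s₀ = 3) :
    0 ≤ G.cubeSumQuad m kernel17 := by
  classical
  unfold cubeSumQuad cubeSum
  -- only rows `0` and `s₀` occur
  have hvan : ∀ (ρ : Config E) (s : Fin 5), s ≠ 0 → s ≠ s₀ → rowInd3 s (G.markedPartition ρ m) = 0 := by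
    intro ρ s hs0 hss
    refine rowInd3_eq_zero_of_joined ?_ (G.markedPartition_rel_of_eq ρ m h)
    intro heq
    rcases hrows s heq with h0 | h0
    · exact hs0 h0
    · exact hss h0
  -- the kernel on the two occurring rows: `[σ = s₀] − [σ = 0]·[τ = s₀]`
  have hker : ∀ ρ : Config E, kernel17 (G.markedPartition ρ m) (G.markedPartition ρᶜ m) =
      rowInd3 s₀ (G.markedPartition ρ m) -
        rowInd3 0 (G.markedPartition ρ m) * rowInd3 s₀ (G.markedPartition ρᶜ m) := by
    intro ρ
    unfold kernel17
    rcases hs₀ with rfl | rfl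
    · rw [hvan ρ 1 (by decide) (by decide), hvan ρ 3 (by decide) (by decide),
        hvan ρᶜ 3 (by decide) (by decide), hvan ρᶜ 4 (by decide) (by decide)]
      ring
    · rw [hvan ρ 1 (by decide) (by decide), hvan ρ 2 (by decide) (by decide),
        hvan ρᶜ 2 (by decide) (by decide), hvan ρᶜ 4 (by decide) (by decide)]
      ring
  simp only [hker, Finset.sum_sub_distrib]
  rw [sub_nonneg]
  -- `Σ_ρ [ρ ∈ 0]·[ρᶜ ∈ s₀] ≤ Σ_ρ [ρ ∈ s₀]`: the map `ρ ↦ ρᶜ` injects the first set into the second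
  have hind : ∀ (ρ : Config E) (s : Fin 5),
      rowInd3 s (G.markedPartition ρ m) = if G.markedPartition ρ m = Setoid.ker (rgs3 s) then 1 else 0 :=
    fun ρ s => rfl
  simp only [hind, mul_ite, mul_one, mul_zero, ← ite_and]
  rw [← Finset.sum_filter, ← Finset.sum_filter]
  simp only [Finset.sum_const, nsmul_eq_mul, mul_one]
  norm_cast
  refine Finset.card_le_card_of_injOn (fun ρ => ρᶜ) ?_ ?_
  · intro ρ hρ
    simp only [Finset.coe_filter, Finset.mem_univ, true_and, Set.mem_setOf_eq] at hρ ⊢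
    exact hρ.1
  · intro ρ _ ρ' _ hρρ'
    exact compl_injective hρρ'

/-- **The C-017 class sum is nonnegative for every non-injective marking** (mine-3 07:30:06Z). -/
theorem cubeSumQuad_kernel17_nonneg_of_not_injective (m : Fin 3 → V)
    (h : ¬ Function.Injective m) : 0 ≤ G.cubeSumQuad m kernel17 := by
  obtain ⟨i, j, hij, hne⟩ : ∃ i j, m i = m j ∧ i ≠ j := by
    unfold Function.Injective at h
    push Not at h
    obtain ⟨i, j, h1, h2⟩ := h
    exact ⟨i, j, h1, h2⟩
  -- reduce to the three unordered pairs
  have key : ∀ i j : Fin 3, i ≠ j → m i = m j → 0 ≤ G.cubeSumQuad m kernel17 := by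
    intro i j hne hij
    fin_cases i <;> fin_cases j
    all_goals first
      | exact absurd rfl hne
      | exact Finset.sum_nonneg fun ρ _ => G.kernel17_nonneg_of_eq01 ρ ρᶜ m hij
      | exact Finset.sum_nonneg fun ρ _ => G.kernel17_nonneg_of_eq01 ρ ρᶜ m hij.symm
      | exact G.cubeSumQuad_kernel17_nonneg_of_pair m 2 0 2 hij (by decide) (Or.inl rfl)
      | exact G.cubeSumQuad_kernel17_nonneg_of_pair m 2 2 0 hij (by decide) (Or.inl rfl)
      | exact G.cubeSumQuad_kernel17_nonneg_of_pair m 3 1 2 hij (by decide) (Or.inr rfl)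
      | exact G.cubeSumQuad_kernel17_nonneg_of_pair m 3 2 1 hij (by decide) (Or.inr rfl)
  exact key i j hne hij

end MultiGraph

/-- **`A` is class-positive on the SIMPLE graphs with ≤ N vertices and INJECTIVE marks** — the
census over `k`-subsets. -/
def ClassPositiveSimpleInjUpTo (k N : ℕ) (A : Setoid (Fin k) → Setoid (Fin k) → ℝ) : Prop :=
  ∀ {V E : Type} [Fintype V] [Fintype E] [DecidableEq E], Fintype.card V ≤ N →
    ∀ (G : MultiGraph V E), G.IsSimple → ∀ m : Fin k → V, Function.Injective m →
      0 ≤ G.cubeSumQuad m A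

/-- For `kernel17` the injective census gives the full hypothesis. -/
theorem ClassPositiveSimpleUpTo_kernel17_of_inj {N : ℕ}
    (h : ClassPositiveSimpleInjUpTo 3 N kernel17) : ClassPositiveSimpleUpTo 3 N kernel17 := by
  intro V E _ _ _ hV G hs m
  by_cases hm : Function.Injective m
  · exact h hV G hs m hm
  · exact G.cubeSumQuad_kernel17_nonneg_of_not_injective m hm

/-- **C-017 on ≤ N vertices from the injective simple-graph class census** (mine-3's 3-subset
classvec table). -/
theorem C017UpTo_of_simpleInj {N : ℕ} (h : ClassPositiveSimpleInjUpTo 3 N kernel17) :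
    C017UpTo N :=
  C017UpTo_of_simple (ClassPositiveSimpleUpTo_kernel17_of_inj h)

end PercRepro
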